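import Literature.NumberTheory.EllipticCurves.KubertTateFiveVeluIsogeny
import Literature.NumberTheory.EllipticCurves.KubertTateFiveKummerDivisor
import HarnessLib

/-!
# The kernel of Vélu's `5`-isogeny of `E_{m,n}` is `⟨T̄⟩`, `T̄ = (0,0)` of order `5`

PROOF-ONLY file (theorems only), topic `NumberTheory/EllipticCurves`; sequel of
`KubertTateFiveVeluIsogeny`. For the universal `5`-torsion curve
`E_{m,n} = kubertTateFive m n = [n-m, -mn, -mn², 0, 0]` over a field `K` of characteristic `0` with
`E_{m,n}` elliptic, and Vélu's isogeny `φ = fiveIsogeny m n : E_{m,n} → E'_{m,n}` of the tree: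

* `Tbar_mem_ker` — **`T̄ = (0,0) ∈ ker φ`**, with no chord–tangent computation: `ker φ` has `5`
  elements (`natCard_ker_fiveIsogeny`) and lies in the five-element set
  `{O, (0,0), (0,mn²), (mn,0), (mn,m²n)}` (`mem_ker_fiveIsogeny_imp`), so it is that set (the
  device of the tree's `X1ElevenFiveIsogeny.Tbar_mem_ker`);
* `ker_fiveIsogeny_eq_zmultiples` — **`ker φ = ⟨T̄⟩`**; `addOrderOf_Tbar` — **`T̄` has order `5`**;
  `five_nsmul_Tbar`, `five_zsmul_Tbar`, `smul_Tbar` (`Γ_K` fixes `T̄`).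

Here `T̄ = KubertTateKummer.Tbar m n` is the marked point of `KubertTateFiveKummerDivisor`, so that
these facts plug into the Kummer theory of `f_T = xy - nx² + n²y` (`ord_kummerFn`).

## References

* [Velu1971] J. Vélu, *Isogénies entre courbes elliptiques*, C. R. Acad. Sci. Paris 273 (1971).
* [Kubert1976] D. S. Kubert, *Universal bounds on the torsion of elliptic curves*, Table 3.
* [SilvermanAEC2009] J. H. Silverman, *AEC*, 2nd ed., Thm. III.4.10(c).
-/

noncomputable section

open scoped Classical
open Polynomial WeierstrassCurve Field
open Literature.NumberTheory.EllipticCurves Literature.NumberTheory.EllipticCurves.KubertTateKummer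

universe u

namespace Literature.NumberTheory.EllipticCurves

namespace KubertTateVelu

variable {K : Type u} [Field K] (m n : K) [CharZero K] [hE : (kubertTateFive m n).IsElliptic]

/-- `(0, mn²)`, `(mn, 0)`, `(mn, m²n)` are points of `E_{m,n}/K̄`. [cite: Velu1971, formulae] -/
theorem nonsingular_candidates :
    ((kubertTateFive m n).baseChange (AlgebraicClosure K)).toAffine.Nonsingular 0
        (algebraMap K (AlgebraicClosure K) (m * n ^ 2)) ∧
      ((kubertTateFive m n).baseChange (AlgebraicClosure K)).toAffine.Nonsingular
        (algebraMap K (AlgebraicClosure K) (m * n)) 0 ∧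
      ((kubertTateFive m n).baseChange (AlgebraicClosure K)).toAffine.Nonsingular
        (algebraMap K (AlgebraicClosure K) (m * n)) (algebraMap K (AlgebraicClosure K) (m ^ 2 * n)) := by
  refine ⟨(nonsingular_geom_iff m n _ _).mpr ?_, (nonsingular_geom_iff m n _ _).mpr ?_,
    (nonsingular_geom_iff m n _ _).mpr ?_⟩ <;>
  · simp only [map_mul, map_pow]; ring

/-- The kernel of `φ` lies in a five-element set of geometric points containing `T̄`.
[cite: Velu1971, formulae] -/
theorem ker_fiveIsogeny_subset_five :
    ∃ F : Finset (geomPoints (kubertTateFive m n)), F.card ≤ 5 ∧ Tbar m n ∈ F ∧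
      ((fiveIsogeny m n).toAddMonoidHom.ker : Set (geomPoints (kubertTateFive m n))) ⊆ F := by
  obtain ⟨h01, h10, h11⟩ := nonsingular_candidates m n
  let P01 : geomPoints (kubertTateFive m n) := Affine.Point.some _ _ h01
  let P10 : geomPoints (kubertTateFive m n) := Affine.Point.some _ _ h10
  let P11 : geomPoints (kubertTateFive m n) := Affine.Point.some _ _ h11
  refine ⟨{0, Tbar m n, P01, P10, P11}, ?_, Finset.mem_insert_of_mem (Finset.mem_insert_self _ _), ?_⟩
  · exact (Finset.card_insert_le _ _).trans (Nat.succ_le_succ ((Finset.card_insert_le _ _).trans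
      (Nat.succ_le_succ ((Finset.card_insert_le _ _).trans (Nat.succ_le_succ
        ((Finset.card_insert_le _ _).trans (Nat.succ_le_succ (Finset.card_singleton _).le)))))))
  · intro P hP
    have hP0 : fiveIsogeny m n P = 0 := hP
    rw [Finset.mem_coe]
    simp only [Finset.mem_insert, Finset.mem_singleton]
    rcases mem_ker_fiveIsogeny_imp m n hP0 with rfl | ⟨x, y, h, rfl, ⟨hx, hy | hy⟩ | ⟨hx, hy | hy⟩⟩
    · exact Or.inl rfl
    · subst hx; subst hy; exact Or.inr (Or.inl rfl)
    · subst hx; subst hy; exact Or.inr (Or.inr (Or.inl rfl))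
    · subst hx; subst hy; exact Or.inr (Or.inr (Or.inr (Or.inl rfl)))
    · subst hx; subst hy; exact Or.inr (Or.inr (Or.inr (Or.inr rfl)))

/-- **`T̄ ∈ ker φ`**: `ker φ` has `5` elements and lies in a five-element set containing `T̄`.
[cite: SilvermanAEC2009, Thm. III.4.10(c)] -/
theorem Tbar_mem_ker : Tbar m n ∈ (fiveIsogeny m n).toAddMonoidHom.ker := by
  by_contra hT
  obtain ⟨F, hF5, hTF, hsub⟩ := ker_fiveIsogeny_subset_five m n
  have hsub' : ((fiveIsogeny m n).toAddMonoidHom.ker : Set (geomPoints (kubertTateFive m n))) ⊆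
      ↑(F.erase (Tbar m n)) := by
    intro P hP
    rw [Finset.coe_erase]
    exact ⟨hsub hP, fun h => hT (h ▸ hP)⟩
  have h1 : ((fiveIsogeny m n).toAddMonoidHom.ker : Set (geomPoints (kubertTateFive m n))).ncard ≤ 4 := by
    calc ((fiveIsogeny m n).toAddMonoidHom.ker : Set (geomPoints (kubertTateFive m n))).ncard
        ≤ (↑(F.erase (Tbar m n)) : Set _).ncard := Set.ncard_le_ncard hsub' (Finset.finite_toSet _)
      _ = (F.erase (Tbar m n)).card := Set.ncard_coe_finset _
      _ ≤ 4 := by rw [Finset.card_erase_of_mem hTF]; omega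
  have h2 := natCard_ker_fiveIsogeny m n
  rw [← SetLike.coe_sort_coe, Nat.card_coe_set_eq] at h2
  omega

/-- **`T̄` has order `5`.** [cite: Kubert1976, Table 3 (N = 5)] -/
theorem addOrderOf_Tbar : addOrderOf (Tbar m n) = 5 := by
  haveI : Finite (fiveIsogeny m n).toAddMonoidHom.ker := (fiveIsogeny m n).finite_ker'
  have hdvd : addOrderOf (Tbar m n) ∣ 5 := by
    have h := addOrderOf_dvd_natCard (⟨Tbar m n, Tbar_mem_ker m n⟩ : (fiveIsogeny m n).toAddMonoidHom.ker)
    rw [natCard_ker_fiveIsogeny, AddSubgroup.addOrderOf_mk] at h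
    exact h
  rcases (Nat.dvd_prime Nat.prime_five).mp hdvd with h1 | h5
  · exact absurd (AddMonoid.addOrderOf_eq_one_iff.mp h1) (Tbar_ne_zero m n)
  · exact h5

/-- **`ker φ = ⟨T̄⟩`** (`⟨T̄⟩ ≤ ker φ`, both of order `5`). [cite: SilvermanAEC2009, Thm. III.4.10(c)] -/
theorem ker_fiveIsogeny_eq_zmultiples :
    (fiveIsogeny m n).toAddMonoidHom.ker = AddSubgroup.zmultiples (Tbar m n) := by
  haveI : Finite (fiveIsogeny m n).toAddMonoidHom.ker := (fiveIsogeny m n).finite_ker'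
  have hle : AddSubgroup.zmultiples (Tbar m n) ≤ (fiveIsogeny m n).toAddMonoidHom.ker :=
    AddSubgroup.zmultiples_le.mpr (Tbar_mem_ker m n)
  refine (AddSubgroup.eq_of_le_of_card_ge hle ?_).symm
  rw [natCard_ker_fiveIsogeny, Nat.card_zmultiples, addOrderOf_Tbar]

/-- `5 T̄ = O`. [cite: Kubert1976, Table 3 (N = 5)] -/
theorem five_nsmul_Tbar : (5 : ℕ) • Tbar m n = 0 := by
  rw [← addOrderOf_Tbar m n]; exact addOrderOf_nsmul_eq_zero (Tbar m n)

/-- `5 T̄ = O` (integer multiple). [cite: Kubert1976, Table 3 (N = 5)] -/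
theorem five_zsmul_Tbar : ((5 : ℕ) : ℤ) • Tbar m n = 0 := by
  rw [natCast_zsmul]; exact five_nsmul_Tbar m n

/-- `Γ_K` fixes `T̄`. [cite: Kubert1976, Table 3 (N = 5)] -/
theorem smul_Tbar (σ : absoluteGaloisGroup K) : σ • Tbar m n = Tbar m n :=
  smul_eq_of_mem_ker m n σ _ (Tbar_mem_ker m n)

/-- A multiple of `T̄` is `O` or an affine point with `x ∈ {0, mn}`. [cite: Velu1971, formulae] -/
theorem eq_zero_or_x_mem_of_mem_zmultiples {P : geomPoints (kubertTateFive m n)}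
    (hP : P ∈ AddSubgroup.zmultiples (Tbar m n)) :
    P = 0 ∨ ∃ (x y : AlgebraicClosure K) (h : _), P = Affine.Point.some x y h ∧
      (x = 0 ∨ x = algebraMap K (AlgebraicClosure K) (m * n)) := by
  rw [← ker_fiveIsogeny_eq_zmultiples] at hP
  rcases mem_ker_fiveIsogeny_imp m n (show fiveIsogeny m n P = 0 from hP) with h | ⟨x, y, h, rfl, hxy⟩
  · exact Or.inl h
  · exact Or.inr ⟨x, y, h, rfl, hxy.imp (fun h ↦ h.1) (fun h ↦ h.1)⟩

end KubertTateVelu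

end Literature.NumberTheory.EllipticCurves

end
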